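import Summits.CriticalPhenomena.Ising3DConformalLimit.Theorems.EnergyNotSigmaSquaredMoebiusLimitExistsOneMapOneJetDefs
import Summits.CriticalPhenomena.Ising3DConformalLimit.Theorems.PrecisionLaplacianMoebiusLimitOfTwoPointLawInversionBegetsRotations
import HarnessLib

/-!
# Line `one-map-one-jet` (crux `MoebiusLimitExists`, stmt-CriticalPhenomena-1344): ORDER 1 of the residual stub —
the equal-radial-weights law

The residual stub `stub_inversionGerm_even_ge_four` asks for the GERM of the inversion defect
`D_n = S n ∘ ι − (∏‖x i‖^{2Δ}) S n` to vanish at a point of the prover's choice in each path-component of the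
doubly-good set. On the fixed unit sphere of `ι` (all `‖x i‖ = 1`) order 0 is free
(`inversionDefect_eq_zero_of_norm_eq_one`). This file computes ORDER 1 there for any family differentiable
at such a configuration: the derivative of `D_n` at `x₀` is
`h ↦ −2 ∑ᵢ ⟪x₀ i, h i⟫ · (∂S_n/∂(radial i) (x₀) + Δ S_n(x₀))` (`hasFDerivAt_inversionDefect_of_norm_eq_one`,
`inversionDefectDeriv_apply`), so it vanishes iff the EQUAL-RADIAL-WEIGHTS LAW
`(x₀ i · ∇ᵢ) S_n (x₀) + Δ S_n (x₀) = 0` holds for EACH `i` separately (`inversionDefectDeriv_eq_zero_iff`) — the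
sum over `i` being the scale Ward identity, which is all that similarity covariance gives. This is the first
graded piece of the conjecture content of the line (card `Ideas/one-map-one-jet.md`, triage r1-3), in Lean.
-/

noncomputable section

open Set Function Filter EuclideanGeometry ContinuousLinearMap
open scoped Topology RealInnerProductSpace
open Literature.Probability.LatticeModels

namespace Summit.CriticalPhenomena.Ising3DConformalLimit.MoebiusLimitExistsOneMapOneJet

variable {n : ℕ}

/-- Derivative of `invCfg` off the pole: pointwise the derivative of the unit inversion,
`(1/‖x₀ i‖)² •` reflection in `(ℝ ∙ x₀ i)ᗮ` (Mathlib `hasFDerivAt_inversion`). [folklore] -/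
theorem hasFDerivAt_invCfg {x₀ : Fin n → EuclideanSpace ℝ (Fin 3)} (hx : ∀ i, x₀ i ≠ 0) :
    HasFDerivAt (invCfg (n := n))
      (ContinuousLinearMap.pi fun i =>
        ((1 / dist (x₀ i) 0) ^ 2 • ((ℝ ∙ (x₀ i - 0))ᗮ.reflection :
          EuclideanSpace ℝ (Fin 3) →L[ℝ] EuclideanSpace ℝ (Fin 3))).comp (proj i)) x₀ := by
  rw [show (invCfg (n := n)) = fun y i => inversion 0 1 (y i) from rfl]
  refine hasFDerivAt_pi.2 fun i => ?_
  have hf : HasFDerivAt (fun y : Fin n → EuclideanSpace ℝ (Fin 3) => y i) (proj i) x₀ :=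
    hasFDerivAt_apply (𝕜 := ℝ) i x₀
  have hg : HasFDerivAt (inversion (0 : EuclideanSpace ℝ (Fin 3)) 1)
      ((1 / dist (x₀ i) 0) ^ 2 • ((ℝ ∙ (x₀ i - 0))ᗮ.reflection :
          EuclideanSpace ℝ (Fin 3) →L[ℝ] EuclideanSpace ℝ (Fin 3))) (x₀ i) :=
    hasFDerivAt_inversion (hx i)
  exact hg.comp x₀ hf

/-- Derivative of the weight factor `y ↦ ‖y i‖^{2Δ}` at a configuration with `‖x₀ i‖ = 1`:
`(2Δ) • ⟪x₀ i, · i⟫`. [folklore] -/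
theorem hasFDerivAt_normFactor {x₀ : Fin n → EuclideanSpace ℝ (Fin 3)} (Δ : ℝ) (i : Fin n)
    (hx : ‖x₀ i‖ = 1) :
    HasFDerivAt (fun y : Fin n → EuclideanSpace ℝ (Fin 3) => ‖y i‖ ^ (2 * Δ))
      ((2 * Δ) • (innerSL ℝ (x₀ i)).comp (proj i)) x₀ := by
  have hsq : HasFDerivAt (fun y : Fin n → EuclideanSpace ℝ (Fin 3) => ‖y i‖ ^ 2)
      ((2 : ℕ) • (innerSL ℝ (x₀ i)).comp (proj i)) x₀ := by
    have h := (hasFDerivAt_apply i x₀ (𝕜 := ℝ)).norm_sq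
    simpa [ContinuousLinearMap.comp_smul] using h
  have hne : (fun y : Fin n → EuclideanSpace ℝ (Fin 3) => ‖y i‖ ^ 2) x₀ ≠ 0 := by
    simp [hx]
  have h := hsq.rpow_const (p := Δ) (Or.inl hne)
  have hfun : (fun y : Fin n → EuclideanSpace ℝ (Fin 3) => (‖y i‖ ^ 2) ^ Δ) =
      fun y => ‖y i‖ ^ (2 * Δ) := by
    funext y
    rw [← Real.rpow_two, ← Real.rpow_mul (norm_nonneg _)]
  rw [hfun] at h
  refine h.congr_fderiv ?_
  ext1 v
  simp only [hx, smul_apply, ContinuousLinearMap.coe_comp, Function.comp_apply,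
    smul_eq_mul, nsmul_eq_mul, one_pow, Real.one_rpow, mul_one, Nat.cast_ofNat]
  ring

/-- Derivative of the full weight `y ↦ ∏ᵢ ‖y i‖^{2Δ}` at a unit-sphere configuration:
`(2Δ) • ∑ᵢ ⟪x₀ i, · i⟫`. [folklore] -/
theorem hasFDerivAt_normWeight {x₀ : Fin n → EuclideanSpace ℝ (Fin 3)} (Δ : ℝ) (hx : ∀ i, ‖x₀ i‖ = 1) :
    HasFDerivAt (fun y : Fin n → EuclideanSpace ℝ (Fin 3) => ∏ i, ‖y i‖ ^ (2 * Δ))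
      ((2 * Δ) • ∑ i, (innerSL ℝ (x₀ i)).comp (proj i)) x₀ := by
  classical
  have h : HasFDerivAt (fun y : Fin n → EuclideanSpace ℝ (Fin 3) => ∏ i, ‖y i‖ ^ (2 * Δ))
      (∑ i ∈ Finset.univ, (∏ j ∈ Finset.univ.erase i, ‖x₀ j‖ ^ (2 * Δ)) •
        ((2 * Δ) • (innerSL ℝ (x₀ i)).comp (proj i))) x₀ :=
    HasFDerivAt.finsetProd (u := Finset.univ) (fun i _ => hasFDerivAt_normFactor Δ i (hx i))
  refine h.congr_fderiv ?_
  have hone : ∀ i, (∏ j ∈ Finset.univ.erase i, ‖x₀ j‖ ^ (2 * Δ)) = 1 := fun i =>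
    Finset.prod_eq_one fun j _ => by rw [hx j, Real.one_rpow]
  simp only [hone, one_smul, Finset.smul_sum]

/-- At a unit-sphere configuration the derivative of `invCfg` is the pointwise reflection
`h ↦ (reflection in (ℝ ∙ x₀ i)ᗮ of h i)ᵢ`. [folklore] -/
theorem hasFDerivAt_invCfg_of_norm_eq_one {x₀ : Fin n → EuclideanSpace ℝ (Fin 3)} (hx : ∀ i, ‖x₀ i‖ = 1) :
    HasFDerivAt (invCfg (n := n))
      (ContinuousLinearMap.pi fun i =>
        (((ℝ ∙ x₀ i)ᗮ.reflection : EuclideanSpace ℝ (Fin 3) →L[ℝ] EuclideanSpace ℝ (Fin 3))).comp (proj i)) x₀ := by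
  have hx0 : ∀ i, x₀ i ≠ 0 := fun i => by rw [← norm_ne_zero_iff, hx i]; exact one_ne_zero
  refine (hasFDerivAt_invCfg hx0).congr_fderiv ?_
  congr 1
  funext i
  rw [dist_eq_norm, sub_zero, hx i, div_one, one_pow, one_smul]

/-- **Order 1 of the inversion defect on the fixed sphere (raw chain rule).** If `S n` has derivative `L`
at a configuration `x₀` with all `‖x₀ i‖ = 1`, then `D_n = S n ∘ ι − (∏‖· i‖^{2Δ}) S n` has derivative
`L ∘ (pointwise reflections) − L − S n x₀ · (2Δ) ∑ᵢ ⟪x₀ i, · i⟫` at `x₀`. [folklore] -/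
theorem hasFDerivAt_inversionDefect_of_norm_eq_one (Δ : ℝ) (S : CorrFamily 3)
    {x₀ : Fin n → EuclideanSpace ℝ (Fin 3)} (hx : ∀ i, ‖x₀ i‖ = 1)
    {L : (Fin n → EuclideanSpace ℝ (Fin 3)) →L[ℝ] ℝ} (hS : HasFDerivAt (S n) L x₀) :
    HasFDerivAt (inversionDefect Δ S n)
      (L.comp (ContinuousLinearMap.pi fun i =>
          (((ℝ ∙ x₀ i)ᗮ.reflection : EuclideanSpace ℝ (Fin 3) →L[ℝ] EuclideanSpace ℝ (Fin 3))).comp (proj i))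
        - L - (S n x₀) • ((2 * Δ) • ∑ i, (innerSL ℝ (x₀ i)).comp (proj i))) x₀ := by
  have hfix : invCfg x₀ = x₀ := funext fun i => inversion_of_mem_sphere (by simp [hx i])
  have hι := hasFDerivAt_invCfg_of_norm_eq_one hx
  have hS' : HasFDerivAt (S n) L (invCfg x₀) := by rw [hfix]; exact hS
  have hSι : HasFDerivAt (fun y => S n (invCfg y)) (L.comp (ContinuousLinearMap.pi fun i =>
      (((ℝ ∙ x₀ i)ᗮ.reflection : EuclideanSpace ℝ (Fin 3) →L[ℝ] EuclideanSpace ℝ (Fin 3))).comp (proj i))) x₀ :=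
    hS'.comp x₀ hι
  have hw := hasFDerivAt_normWeight Δ hx
  have hwS := hw.mul hS
  have hw1 : (∏ i, ‖x₀ i‖ ^ (2 * Δ)) = 1 := Finset.prod_eq_one fun i _ => by rw [hx i, Real.one_rpow]
  have hD : inversionDefect Δ S n = fun y => S n (invCfg y) - (∏ i, ‖y i‖ ^ (2 * Δ)) * S n y := rfl
  rw [hD]
  refine (hSι.sub hwS).congr_fderiv ?_
  rw [hw1, one_smul]
  abel

/-- Mathlib's reflection in `(ℝ ∙ v)ᗮ` for a UNIT vector `v`: `y ↦ y − 2⟪y, v⟫ v`. [folklore] -/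
theorem reflection_orthogonal_unit {v : EuclideanSpace ℝ (Fin 3)} (hv : ‖v‖ = 1) (y : EuclideanSpace ℝ (Fin 3)) :
    (ℝ ∙ v)ᗮ.reflection y = y - (2 * inner ℝ y v) • v := by
  rw [Summit.CriticalPhenomena.Ising3DConformalLimit.PrecisionLaplacianMoebiusLimitOfTwoPointLaw.reflection_orthogonal_singleton_eq,
    hv, one_pow, div_one]

/-- **The order-1 derivative in coordinates**: at a unit-sphere configuration,
`D_n'(x₀) h = −2 ∑ᵢ ⟪x₀ i, h i⟫ (L (Pi.single i (x₀ i)) + Δ S n x₀)` — the `i`-th radial derivative of `S n`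
plus `Δ S n`, weighted by the radial component of `h i`. [folklore] -/
theorem inversionDefectDeriv_apply (Δ : ℝ) (S : CorrFamily 3)
    {x₀ : Fin n → EuclideanSpace ℝ (Fin 3)} (hx : ∀ i, ‖x₀ i‖ = 1)
    (L : (Fin n → EuclideanSpace ℝ (Fin 3)) →L[ℝ] ℝ) (h : Fin n → EuclideanSpace ℝ (Fin 3)) :
    (L.comp (ContinuousLinearMap.pi fun i =>
          (((ℝ ∙ x₀ i)ᗮ.reflection : EuclideanSpace ℝ (Fin 3) →L[ℝ] EuclideanSpace ℝ (Fin 3))).comp (proj i))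
        - L - (S n x₀) • ((2 * Δ) • ∑ i, (innerSL ℝ (x₀ i)).comp (proj i))) h =
      -2 * ∑ i, inner ℝ (x₀ i) (h i) * (L (Pi.single i (x₀ i)) + Δ * S n x₀) := by
  classical
  -- the reflected configuration minus `h` is a sum of single-slot radial vectors
  have hrefl : (ContinuousLinearMap.pi fun i =>
      (((ℝ ∙ x₀ i)ᗮ.reflection : EuclideanSpace ℝ (Fin 3) →L[ℝ] EuclideanSpace ℝ (Fin 3))).comp (proj i)) h =
        h + ∑ i, Pi.single i ((-(2 * inner ℝ (x₀ i) (h i))) • x₀ i) := by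
    have hsum : (∑ i, Pi.single i ((-(2 * inner ℝ (x₀ i) (h i))) • x₀ i) : Fin n → EuclideanSpace ℝ (Fin 3)) =
        fun i => (-(2 * inner ℝ (x₀ i) (h i))) • x₀ i :=
      Finset.univ_sum_single (fun i => (-(2 * inner ℝ (x₀ i) (h i))) • x₀ i)
    rw [hsum]
    funext i
    have e1 : (ContinuousLinearMap.pi fun i =>
        (((ℝ ∙ x₀ i)ᗮ.reflection : EuclideanSpace ℝ (Fin 3) →L[ℝ] EuclideanSpace ℝ (Fin 3))).comp (proj i)) h i =
          (ℝ ∙ x₀ i)ᗮ.reflection (h i) := rfl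
    rw [e1, reflection_orthogonal_unit (hx i), real_inner_comm, Pi.add_apply, sub_eq_add_neg, neg_smul]
  simp only [sub_apply, smul_apply, ContinuousLinearMap.coe_comp,
    Function.comp_apply, hrefl, map_add, map_sum, sum_apply,
    innerSL_apply_apply, ContinuousLinearMap.proj_apply, smul_eq_mul]
  have hlin : ∀ i, L (Pi.single i ((-(2 * inner ℝ (x₀ i) (h i))) • x₀ i)) =
      (-(2 * inner ℝ (x₀ i) (h i))) * L (Pi.single i (x₀ i)) := fun i => by
    rw [Pi.single_smul, map_smul, smul_eq_mul]
  simp only [hlin, Finset.mul_sum]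
  rw [add_sub_cancel_left]
  rw [← Finset.sum_sub_distrib]
  refine Finset.sum_congr rfl fun i _ => ?_
  ring

/-- **EQUAL RADIAL WEIGHTS (order 1 of the residual stub).** At a unit-sphere configuration the order-1
jet of the inversion defect vanishes iff, for EACH point `i` separately, the radial derivative law
`L (Pi.single i (x₀ i)) + Δ · S n x₀ = 0` holds (`L` = the derivative of `S n` at `x₀`; the sum over `i` is
the scale Ward identity). [folklore] -/
theorem inversionDefectDeriv_eq_zero_iff (Δ : ℝ) (S : CorrFamily 3)
    {x₀ : Fin n → EuclideanSpace ℝ (Fin 3)} (hx : ∀ i, ‖x₀ i‖ = 1)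
    (L : (Fin n → EuclideanSpace ℝ (Fin 3)) →L[ℝ] ℝ) :
    (L.comp (ContinuousLinearMap.pi fun i =>
          (((ℝ ∙ x₀ i)ᗮ.reflection : EuclideanSpace ℝ (Fin 3) →L[ℝ] EuclideanSpace ℝ (Fin 3))).comp (proj i))
        - L - (S n x₀) • ((2 * Δ) • ∑ i, (innerSL ℝ (x₀ i)).comp (proj i))) = 0 ↔
      ∀ i, L (Pi.single i (x₀ i)) + Δ * S n x₀ = 0 := by
  classical
  constructor
  · intro h0 j
    have h := congrArg (fun T : (Fin n → EuclideanSpace ℝ (Fin 3)) →L[ℝ] ℝ => T (Pi.single j (x₀ j))) h0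
    simp only [zero_apply] at h
    rw [inversionDefectDeriv_apply Δ S hx L] at h
    have hin : ∀ i, inner ℝ (x₀ i) ((Pi.single j (x₀ j) : Fin n → EuclideanSpace ℝ (Fin 3)) i) =
        if i = j then 1 else 0 := by
      intro i
      by_cases hij : i = j
      · subst hij
        rw [Pi.single_eq_same, if_pos rfl, real_inner_self_eq_norm_sq, hx i, one_pow]
      · rw [Pi.single_eq_of_ne hij, inner_zero_right, if_neg hij]
    simp only [hin, ite_mul, one_mul, zero_mul, Finset.sum_ite_eq', Finset.mem_univ, if_true] at h
    linarith
  · intro hall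
    ext1 h
    rw [inversionDefectDeriv_apply Δ S hx L, zero_apply]
    simp only [hall, mul_zero, Finset.sum_const_zero]

/-- **Registered anchor `radialLaw_of_inversionGerm` — ORDER 1 OF THE RESIDUAL STUB IS THE EQUAL-RADIAL-WEIGHTS
LAW.** If the germ of the inversion defect of a family `S` (weight `Δ`) vanishes at a unit-sphere configuration
`x₀` (all `‖x₀ i‖ = 1` — there order 0 is free) and `S n` is differentiable at `x₀` with derivative `L`, then
for EACH `i` the radial derivative law `L (Pi.single i (x₀ i)) + Δ · S n x₀ = 0` holds: the `i`-th point
carries radial weight exactly `−Δ`. This is what `stub_inversionGerm_even_ge_four` demands at first order at a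
cospherical germ point (card `Ideas/one-map-one-jet.md`: at `n = 4`, asked on all spheres, it is already
Möbius covariance of `S₄`). [folklore] -/
theorem radialLaw_of_inversionGerm :
    ∀ (Δ : ℝ) (S : CorrFamily 3) (n : ℕ) (x₀ : Fin n → EuclideanSpace ℝ (Fin 3)), (∀ i, ‖x₀ i‖ = 1) →
      ∀ L : (Fin n → EuclideanSpace ℝ (Fin 3)) →L[ℝ] ℝ, HasFDerivAt (S n) L x₀ →
      inversionDefect Δ S n =ᶠ[𝓝 x₀] 0 → ∀ i, L (Pi.single i (x₀ i)) + Δ * S n x₀ = 0 := by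
  intro Δ S n x₀ hx L hS hgerm
  have hD := hasFDerivAt_inversionDefect_of_norm_eq_one Δ S hx hS
  have h0 : HasFDerivAt (inversionDefect Δ S n) (0 : (Fin n → EuclideanSpace ℝ (Fin 3)) →L[ℝ] ℝ) x₀ :=
    (hasFDerivAt_const (0 : ℝ) x₀).congr_of_eventuallyEq hgerm
  exact (inversionDefectDeriv_eq_zero_iff Δ S hx L).1 (hD.unique h0)

end Summit.CriticalPhenomena.Ising3DConformalLimit.MoebiusLimitExistsOneMapOneJet

end
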